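import Literature.NumberTheory.EllipticCurves.GeomTorsionDecompositionFixedOfTamagawaProofs
import Literature.NumberTheory.EllipticCurves.TorsionFrobeniusWeilPairingAnnihilatorProofs
import Literature.NumberTheory.EllipticCurves.InertiaTameFactorizationProofs
import Literature.NumberTheory.GaloisRepresentations.DecompositionGroupOfCompletion
import HarnessLib

/-!
# `3 ∣ c_v` at an additive `v ∤ 3`: the QUOTIENT `E[3]/E[3]^{I_v}` is unramified with Frobenius `q_v`
# — via the Weil pairing (theorems only)

`Proofs` file (theorems only: no definition, no named fact, no instance), topic `NumberTheory/EllipticCurves`;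
last file of the series `InertiaFixedTorsionAdditiveIndexBoundProofs` (`E[3]^{I_v}` is at most a line),
`InertiaFixedTorsionOfTamagawaProofs` (exactly a line `A` when `3 ∣ c_v`),
`RationalTorsionOfTamagawaAdditiveProofs` / `GeomTorsionDecompositionFixedOfTamagawaProofs` (`Γ_{K_v}` acts
TRIVIALLY on `A`).  Here the quotient character, from the tree's Weil pairing (`exists_weilPairing_holds`,
Silverman *AEC* III.8.1; CSS Ch. II §8 "`det ρ̄_m = χ_m`"):

* `WeierstrassCurve.smul_sub_nsmul_mem_zmultiples_of_weilPairing` — pure: for a prime `m`, a Weil pairing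
  `e` on `E[m]`, `T₀ ∈ E[m] ∖ O` and `g ∈ Γ_K` with `g T₀ = T₀` and `g ζ = ζ^c` on `μ_m(K̄)`:
  `g S − c S ∈ ⟨T₀⟩` for every `S ∈ E[m]` (the left annihilator of `T₀` is the line `⟨T₀⟩`, and
  `e(gS, T₀) = e(gS, gT₀) = g e(S, T₀) = e(S, T₀)^c = e(cS, T₀)`).
* `WeierstrassCurve.exists_line_geomTorsion_three_quotientCharacter_of_dvd_localTamagawaNumber` — for `E/K`
  elliptic over a number field, `v` ADDITIVE, `v ∤ 3`, `3 ∣ c_v`: the `Γ_{K_v}`-fixed line `A ≤ E[3]`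
  (`#A = 3`, containing every inertia-fixed point of `E[3]`) satisfies **`τ T − T ∈ A` for every `τ` in
  the inertia group `absInertia K_v`** and **`φ T − q_v T ∈ A` for every arithmetic Frobenius lift
  `φ ∈ Γ_{K_v}`** (`q_v = residueFieldCard K_v`), for all `T ∈ E[3]`.  In words: `E[3]|Γ_{K_v}` is a
  RAMIFIED extension `0 → 𝟙 → E[3] → ψ → 0` with `ψ` UNRAMIFIED and `ψ(Frob_v) = q_v mod 3` — so `ψ ≠ 𝟙`
  iff `q_v ≡ 2 (mod 3)`.  This is the shadow lemma of line `shadow_seed` (crux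
  `KobayashiLowerHalfLargeImage`, stmt-BirchSwinnertonDyer-19001) on its `c_q = 3` rows, in FW21 Thm 5.1
  (H3)'s normalisation `(μω ∗; 0 μ)` with `μω = 𝟙`, `μ = ω|_{G_q}`: `μ ≠ 𝟙 ⟺ q ≡ 2 (mod 3)` — exactly
  the card's clause `c_q = 3` for `q % 3 = 2` (all 26 census pairs).

Nothing is asserted about any curve; BSD is not proved by any of this.

## References

* [SilvermanAEC2009] J. H. Silverman, *The Arithmetic of Elliptic Curves*, 2nd ed. (2009): Prop. III.8.1
  (Weil pairing), Thm. VII.6.1.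
* [SerreLocalFields1979] J.-P. Serre, *Local Fields*, Ch. IV §4 Prop. 16 (Frobenius and inertia on roots of
  unity of order prime to `p`).
-/

noncomputable section

open scoped Classical Pointwise
open Field ValuativeRel NumberField IsDedekindDomain IsDedekindDomain.HeightOneSpectrum
open Literature.NumberTheory.EllipticCurves Literature.NumberTheory.GaloisRepresentations
  Literature.NumberTheory.GaloisRepresentations.IsNonarchimedeanLocalField

namespace WeierstrassCurve

variable {K : Type} [Field K] [NumberField K] (W : WeierstrassCurve K) [W.IsElliptic]

/-! ## The left annihilator of a non-zero `T₀ ∈ E[m]` is the line `⟨T₀⟩` (`m` prime) -/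

section Pairing

variable {m : ℕ} (e : geomTorsion W m → geomTorsion W m → AlgebraicClosure K)
  (hμ : ∀ S T, e S T ^ m = 1)
  (haddl : ∀ S₁ S₂ T, e (S₁ + S₂) T = e S₁ T * e S₂ T)
  (halt : ∀ T, e T T = 1)
  (hnd : ∀ T, (∀ S, e S T = 1) → T = 0)
  (hgal : ∀ (σ : absoluteGaloisGroup K) (S T : geomTorsion W m), σ • e S T = e (σ • S) (σ • T))

include hμ haddl in
omit [NumberField K] [W.IsElliptic] in
/-- `e(n • S, T) = e(S, T)^n` (and `e(O, T) = 1`), `m ≠ 0`. [cite: SilvermanAEC2009, Prop. III.8.1(a)] -/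
theorem weilPairing_nsmul_left (hm0 : m ≠ 0) (S T : geomTorsion W m) (n : ℕ) :
    e (n • S) T = e S T ^ n := by
  have h0 : e 0 T = 1 := by
    have hne : e 0 T ≠ 0 := fun h0 ↦ by
      have h := hμ 0 T; rw [h0, zero_pow hm0] at h; exact zero_ne_one h
    have h := haddl 0 0 T
    rw [add_zero] at h
    exact (mul_eq_left₀ hne).1 h.symm
  induction n with
  | zero => rw [zero_smul, pow_zero, h0]
  | succ n ih => rw [add_smul, one_smul, haddl, ih, pow_succ]

include hμ haddl halt hnd hgal in
/-- **`g S − c S ∈ ⟨T₀⟩` from the Weil pairing.**  Let `m` be a prime, `e` a Weil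
pairing on `E[m]` (values in `μ_m`, additive in the first variable, alternating, right-non-degenerate,
Galois-equivariant), `T₀ ∈ E[m]`, `T₀ ≠ O`, and `g ∈ Γ_K` with `g T₀ = T₀` acting on `μ_m(K̄)` by `ζ ↦ ζ^c`.
Then `g S − c • S ∈ ⟨T₀⟩` for every `S ∈ E[m]`: the left annihilator `{S | e(S, T₀) = 1}` is a proper
subgroup of `E[m] ≅ (ℤ/m)²` containing `⟨T₀⟩`, hence equals it, and
`e(gS, T₀) = e(gS, gT₀) = g · e(S, T₀) = e(S, T₀)^c = e(cS, T₀)`.  (CSS Ch. II §8: `det ρ̄_m = χ_m`.)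
[cite: SilvermanAEC2009, Prop. III.8.1 (a)–(d) and Cor. III.6.4(b)] -/
theorem smul_sub_nsmul_mem_zmultiples_of_weilPairing (hm : m.Prime)
    {T₀ : geomTorsion W m} (hT₀ : T₀ ≠ 0) {g : absoluteGaloisGroup K} (hgT₀ : g • T₀ = T₀)
    {c : ℕ} (hgμ : ∀ ζ : AlgebraicClosure K, ζ ^ m = 1 → g • ζ = ζ ^ c) (S : geomTorsion W m) :
    g • S - c • S ∈ AddSubgroup.zmultiples T₀ := by
  have hm0 : m ≠ 0 := hm.ne_zero
  have hne : ∀ S T, e S T ≠ 0 := fun S T h0 ↦ by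
    have h := hμ S T; rw [h0, zero_pow hm0] at h; exact zero_ne_one h
  -- the left annihilator of `T₀`
  set K₀ : AddSubgroup (geomTorsion W m) :=
    { carrier := {S | e S T₀ = 1}
      add_mem' := fun {a b} ha hb ↦ by
        change e (a + b) T₀ = 1
        rw [haddl, show e a T₀ = 1 from ha, show e b T₀ = 1 from hb, one_mul]
      zero_mem' := by
        change e 0 T₀ = 1
        have h := W.weilPairing_nsmul_left e hμ haddl hm0 0 T₀ 0
        rwa [zero_smul, pow_zero] at h
      neg_mem' := fun {a} ha ↦ by
        change e (-a) T₀ = 1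
        have h := haddl (-a) a T₀
        rw [neg_add_cancel, show e a T₀ = 1 from ha, mul_one] at h
        have h0 := W.weilPairing_nsmul_left e hμ haddl hm0 a T₀ 0
        rw [zero_smul, pow_zero] at h0
        rw [← h, h0] } with hK₀
  have hmemK₀ : ∀ S, S ∈ K₀ ↔ e S T₀ = 1 := fun _ ↦ Iff.rfl
  have hT₀K₀ : T₀ ∈ K₀ := (hmemK₀ _).mpr (halt T₀)
  have hzle : AddSubgroup.zmultiples T₀ ≤ K₀ := AddSubgroup.zmultiples_le_of_mem hT₀K₀
  have hK₀top : K₀ ≠ ⊤ := fun htop ↦ hT₀ (hnd T₀ fun S ↦ (hmemK₀ S).mp (htop ▸ AddSubgroup.mem_top S))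
  -- counting: `#E[m] = m²`, `#⟨T₀⟩ = m`, so `K₀ = ⟨T₀⟩`
  haveI : CharZero (AlgebraicClosure K) :=
    charZero_of_injective_algebraMap (algebraMap K (AlgebraicClosure K)).injective
  have hmKbar : ((m : ℕ) : AlgebraicClosure K) ≠ 0 := by exact_mod_cast hm0
  have hcardE : Nat.card (geomTorsion W m) = m ^ 2 :=
    card_torsionBy_eq_sq (E := W.baseChange (AlgebraicClosure K)) (n := m) hmKbar
  haveI : Finite (geomTorsion W m) := Nat.finite_of_card_ne_zero (by rw [hcardE]; positivity)
  haveI : Fact m.Prime := ⟨hm⟩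
  have hmT₀ : m • T₀ = 0 := by
    have h := (mem_geomTorsion_iff W (m : ℤ) (T₀ : geomPoints W)).mp T₀.2
    rw [natCast_zsmul] at h
    exact Subtype.ext (by rw [AddSubmonoidClass.coe_nsmul]; exact h)
  have hcardz : Nat.card (AddSubgroup.zmultiples T₀) = m := by
    rw [Nat.card_zmultiples, addOrderOf_eq_prime hmT₀ hT₀]
  have hK₀dvd : Nat.card K₀ ∣ m ^ 2 := hcardE ▸ AddSubgroup.card_addSubgroup_dvd_card K₀
  obtain ⟨i, hi, hcardK₀⟩ := (Nat.dvd_prime_pow hm).mp hK₀dvd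
  have hi2 : i ≠ 2 := fun h2 ↦ hK₀top (AddSubgroup.eq_top_of_card_eq K₀ (by rw [hcardK₀, h2, hcardE]))
  have hle : Nat.card (AddSubgroup.zmultiples T₀) ≤ Nat.card K₀ := AddSubgroup.card_le_of_le hzle
  rw [hcardz] at hle
  have hcardK₀' : Nat.card K₀ = m := by
    rw [hcardK₀] at hle ⊢
    interval_cases i
    · exact absurd ((pow_zero m).symm.trans_ge hle) (not_le.mpr hm.one_lt)
    · exact pow_one m
    · exact absurd rfl hi2
  have hzK₀ : AddSubgroup.zmultiples T₀ = K₀ :=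
    AddSubgroup.eq_of_le_of_card_ge hzle (by rw [hcardK₀', hcardz])
  -- the pairing computation
  have hgS : e (g • S) T₀ = e (c • S) T₀ := by
    conv_lhs => rw [← hgT₀]
    rw [← hgal, hgμ _ (hμ S T₀), W.weilPairing_nsmul_left e hμ haddl hm0 S T₀ c]
  have hmem : g • S - c • S ∈ K₀ := by
    refine (hmemK₀ _).mpr ?_
    have h : e (g • S - c • S) T₀ * e (c • S) T₀ = e (c • S) T₀ := by rw [← haddl, sub_add_cancel, hgS]
    exact (mul_eq_right₀ (hne _ _)).1 h
  rwa [← hzK₀] at hmem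

end Pairing

/-! ## The quotient character of `E[3]` at an additive `v ∤ 3` with `3 ∣ c_v` -/

/-- **`E[3]|Γ_{K_v}` is an extension of an UNRAMIFIED character with Frobenius value `q_v` by the TRIVIAL
character, at an additive `v ∤ 3` with `3 ∣ c_v`.**  For `E/K` elliptic over a number field, `v` a place of
ADDITIVE reduction with `v ∤ 3` and `3 ∣ c_v = [E(K_v) : E₀(K_v)]`, there is a subgroup `A ≤ E[3]` with
`#A = 3` such that: `Γ_{K_v}` fixes `A` pointwise; every inertia-fixed point of `E[3]` lies in `A`; for every
`τ` in the inertia group `absInertia K_v` and every `T ∈ E[3]`, `τ T − T ∈ A`; and for every arithmetic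
Frobenius lift `φ ∈ Γ_{K_v}` and every `T ∈ E[3]`, `φ T − q_v • T ∈ A` (`q_v = residueFieldCard K_v`;
everything through `absGaloisRestrict K K_v`).  The line is that of
`exists_line_geomTorsion_three_fixed_of_dvd_localTamagawaNumber`; the last two clauses are
`smul_sub_nsmul_mem_zmultiples_of_weilPairing` with the tree's Weil pairing (`exists_weilPairing_holds`),
the inertia group acting trivially on `μ₃` (`InertiaTame.smul_eq_of_mem_inertia_of_pow_eq_one`) and a
Frobenius lift acting by `ζ ↦ ζ^{q_v}` (`absGaloisRestrict_smul_eq_pow_of_pow_eq_one`).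
[cite: SilvermanAEC2009, Prop. III.8.1 and Thm. VII.6.1] [cite: SerreLocalFields1979, Ch. IV §4 Prop. 16] -/
theorem exists_line_geomTorsion_three_quotientCharacter_of_dvd_localTamagawaNumber
    {v : HeightOneSpectrum (𝓞 K)} (hadd : W.HasAdditiveReductionAt v) (h3v : (3 : 𝓞 K) ∉ v.asIdeal)
    (hdvd : 3 ∣ (W.baseChange (v.adicCompletion K)).localTamagawaNumber (v.adicCompletionIntegers K)) :
    ∃ A : AddSubgroup (geomPoints W), A ≤ geomTorsion W (3 : ℤ) ∧ Nat.card A = 3 ∧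
      (∀ σ : absoluteGaloisGroup (v.adicCompletion K), ∀ P ∈ A,
        absGaloisRestrict K (v.adicCompletion K) σ • P = P) ∧
      (∀ P ∈ geomTorsion W (3 : ℤ), (∀ σ ∈ absInertia (v.adicCompletion K),
        absGaloisRestrict K (v.adicCompletion K) σ • P = P) → P ∈ A) ∧
      (∀ τ ∈ absInertia (v.adicCompletion K), ∀ T ∈ geomTorsion W (3 : ℤ),
        absGaloisRestrict K (v.adicCompletion K) τ • T - T ∈ A) ∧
      ∀ φ : absoluteGaloisGroup (v.adicCompletion K), IsFrobPow φ 1 → ∀ T ∈ geomTorsion W (3 : ℤ),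
        absGaloisRestrict K (v.adicCompletion K) φ • T - residueFieldCard (v.adicCompletion K) • T ∈ A := by
  obtain ⟨A, hAle, hAcard, hAfix, hAmax⟩ :=
    W.exists_line_geomTorsion_three_fixed_of_dvd_localTamagawaNumber hadd h3v hdvd
  -- a generator `T₀ ≠ O` of the line, read in `E[3]`
  have hAbot : A ≠ ⊥ := fun h ↦ by
    rw [AddSubgroup.eq_bot_iff_card, hAcard] at h; exact absurd h (by norm_num)
  obtain ⟨⟨T₀, hT₀A⟩, hT₀0⟩ := (AddSubgroup.ne_bot_iff_exists_ne_zero.mp hAbot)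
  have hT₀0' : T₀ ≠ 0 := fun h ↦ hT₀0 (Subtype.ext h)
  set S₀ : geomTorsion W ((3 : ℕ) : ℤ) := ⟨T₀, hAle hT₀A⟩ with hS₀
  have hS₀0 : S₀ ≠ 0 := fun h ↦ hT₀0' (congrArg Subtype.val h)
  -- the Weil pairing on `E[3]`
  have h3K : ((3 : ℕ) : K) ≠ 0 := by norm_num
  obtain ⟨e, hμ, haddl, -, halt, hnd, hgal⟩ := exists_weilPairing_holds W 3 (by norm_num) h3K
  have h3v' : ((3 : ℕ) : 𝓞 K) ∉ v.asIdeal := by exact_mod_cast h3v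
  have hm3 : ¬ ringChar 𝓀[v.adicCompletion K] ∣ 3 := InertiaTame.not_ringChar_dvd v h3v'
  -- from `⟨S₀⟩` in `E[3]` to `A` in `E(K̄)`
  have hcoe : ∀ {g : absoluteGaloisGroup K} {c : ℕ} (S : geomTorsion W ((3 : ℕ) : ℤ)),
      g • S - c • S ∈ AddSubgroup.zmultiples S₀ → g • (S : geomPoints W) - c • (S : geomPoints W) ∈ A := by
    intro g c S h
    obtain ⟨k, hk⟩ := AddSubgroup.mem_zmultiples_iff.mp h
    have hk' := congrArg Subtype.val hk
    simp only [hS₀, AddSubgroupClass.coe_sub, AddSubgroup.torsionBy.coe_smul] at hk'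
    rw [← hk']
    exact A.zsmul_mem hT₀A k
  have hfixS₀ : ∀ σ : absoluteGaloisGroup (v.adicCompletion K),
      absGaloisRestrict K (v.adicCompletion K) σ • S₀ = S₀ := fun σ ↦
    Subtype.ext (by rw [AddSubgroup.torsionBy.coe_smul]; exact hAfix σ T₀ hT₀A)
  refine ⟨A, hAle, hAcard, hAfix, hAmax, fun τ hτ T hT ↦ ?_, fun φ hφ T hT ↦ ?_⟩
  · -- inertia: `c = 1`
    have hτ' : absGaloisRestrict K (v.adicCompletion K) τ ∈
        (adicCompletionPrime K v).inertia (absoluteGaloisGroup K) := by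
      rw [inertia_adicCompletionPrime_eq_map_absInertia]
      exact Subgroup.mem_map_of_mem _ hτ
    have h := W.smul_sub_nsmul_mem_zmultiples_of_weilPairing e hμ haddl halt hnd hgal Nat.prime_three
      hS₀0 (hfixS₀ τ) (c := 1) (fun ζ hζ ↦ by
        rw [pow_one]
        exact InertiaTame.smul_eq_of_mem_inertia_of_pow_eq_one v (by norm_num) h3v'
          (adicCompletionPrime_mem_primesAbove K v) hτ' hζ) ⟨T, hT⟩
    have h' := hcoe ⟨T, hT⟩ h
    rwa [one_smul] at h'
  · -- Frobenius: `c = q_v`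
    exact hcoe ⟨T, hT⟩ (W.smul_sub_nsmul_mem_zmultiples_of_weilPairing e hμ haddl halt hnd hgal
      Nat.prime_three hS₀0 (hfixS₀ φ)
      (fun ζ hζ ↦ absGaloisRestrict_smul_eq_pow_of_pow_eq_one hm3 (by norm_num) hφ hζ) ⟨T, hT⟩)

end WeierstrassCurve

end
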